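import Literature.Geometry.Lorentzian.RicciVariationScalarDecay
import Literature.Geometry.Lorentzian.RicciVariationScalarCurvature
import Literature.Geometry.Lorentzian.CoreSobolev
import HarnessLib

/-!
# Uniform control `|R_t − R| ≤ |t| W` of the scalar curvatures of `ds²_t = ds² + t Ric`
# (Schoen–Yau 1979, (3.28)–(3.29)): the local bound on the core

`RicciVariationScalarDecay.lean` bounds the scalar curvatures of the metrics `ds²_t = ds² + t Ric`
of the proof of Thm. 2 of Schoen–Yau (Comm. Math. Phys. 65 (1979), pp. 72–74) on the far region:
`|R_t − R| ≤ |t| K ‖coord‖⁻⁴` on `far R₁`, uniformly in `|t| ≤ 1`. This file supplies the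
complementary estimate on the compact core and assembles the global domination needed to
differentiate the mass integral under the integral sign ((3.27)–(3.30); "the estimates hold
uniformly for `t` small", (3.28)–(3.29)):

* `exists_lipschitz_scalarJet_near` — the scalar jet function is Lipschitz near every jet with
  invertible metric part (`ContDiffAt.exists_lipschitzOnWith`, `contDiffOn_scalarJet`);
* `exists_nhds_abs_scalarCurvature_ricciFamily_sub_le` — **local bound**: every point `x₀` has a
  neighbourhood `U` with `|R_t(x) − R(x)| ≤ |t| M` on `U` for `|t| < s₀` (in the atlas chart at
  `x₀` the components of `h_t` are `G₀ + t T`, `T` the components of `Ric(h)`, a segment of jets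
  through the continuous jets of `G₀`, `T`; `scalAt_chartRep_eq_scalarCurvatureFn`).

The core bound on the compact complement of a far region (finite subcover) and the global bound
`|R_t(x) − R(x)| ≤ |t| K (1 + ‖coord x‖)⁻⁴` are assembled from this and the far estimate in a
sequel. All results are proved; no definitions, no named facts.

## References

* R. Schoen, S.-T. Yau, *On the proof of the positive mass conjecture in general relativity*,
  Comm. Math. Phys. 65 (1979) 45–76, §3, the family `ds²_t` (p. 72) and (3.27)–(3.29) (p. 73).
-/

noncomputable section

set_option maxSynthPendingDepth 4
set_option synthInstance.maxHeartbeats 400000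
set_option maxHeartbeats 400000

open Set Function Filter Metric Bornology TopologicalSpace Manifold Bundle
open scoped Topology ContDiff Manifold

namespace Literature.Geometry.Lorentzian

open Literature.Geometry.Riemannian PseudoRiemannianMetric

/-! ### The scalar jet function is Lipschitz near every admissible jet -/

/-- **The scalar jet function is locally Lipschitz**: for every jet `(A₀, B₀, T₀)` with `A₀`
invertible there are `ρ > 0` and `M ≥ 0` with
`|𝓢(A', B', T') − 𝓢(A, B, T)| ≤ M max(‖A' − A‖, ‖B' − B‖, ‖T' − T‖)` for all jets `ρ`-close to
`(A₀, B₀, T₀)`, `𝓢(A, B, T) = tr (A⁻¹ ∘ ricciJet (0, A, B, T))` (`contDiffOn_scalarJet`, a `C¹`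
function is Lipschitz near a point). [folklore] -/
theorem exists_lipschitz_scalarJet_near (A₀ : E3 →L[ℝ] E3 →L[ℝ] ℝ) (B₀ : E3 →L[ℝ] E3 →L[ℝ] E3 →L[ℝ] ℝ)
    (T₀ : E3 →L[ℝ] E3 →L[ℝ] E3 →L[ℝ] E3 →L[ℝ] ℝ) (hA₀ : A₀.IsInvertible) :
    ∃ ρ M : ℝ, 0 < ρ ∧ 0 ≤ M ∧
      ∀ (A A' : E3 →L[ℝ] E3 →L[ℝ] ℝ) (B B' : E3 →L[ℝ] E3 →L[ℝ] E3 →L[ℝ] ℝ)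
        (T T' : E3 →L[ℝ] E3 →L[ℝ] E3 →L[ℝ] E3 →L[ℝ] ℝ),
        ‖A - A₀‖ < ρ → ‖B - B₀‖ < ρ → ‖T - T₀‖ < ρ →
        ‖A' - A₀‖ < ρ → ‖B' - B₀‖ < ρ → ‖T' - T₀‖ < ρ →
        |MetricCoord.traceCLM E3 (A'.inverse.comp (MetricCoord.ricciJet ((0 : E3), A', B', T'))) -
            MetricCoord.traceCLM E3 (A.inverse.comp (MetricCoord.ricciJet ((0 : E3), A, B, T)))| ≤
          M * max ‖A' - A‖ (max ‖B' - B‖ ‖T' - T‖) := by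
  set 𝓢 : (E3 →L[ℝ] E3 →L[ℝ] ℝ) × (E3 →L[ℝ] E3 →L[ℝ] E3 →L[ℝ] ℝ) ×
      (E3 →L[ℝ] E3 →L[ℝ] E3 →L[ℝ] E3 →L[ℝ] ℝ) → ℝ := fun q ↦
    MetricCoord.traceCLM E3 (q.1.inverse.comp (MetricCoord.ricciJet ((0 : E3), q.1, q.2.1, q.2.2)))
    with h𝓢
  set j₀ : (E3 →L[ℝ] E3 →L[ℝ] ℝ) × (E3 →L[ℝ] E3 →L[ℝ] E3 →L[ℝ] ℝ) ×
      (E3 →L[ℝ] E3 →L[ℝ] E3 →L[ℝ] E3 →L[ℝ] ℝ) := (A₀, B₀, T₀) with hj₀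
  have hΩo := MetricCoord.isOpen_scalarJetDomain (E := E3)
  have h𝓢s : ContDiffOn ℝ ∞ 𝓢 {q | q.1.IsInvertible} := MetricCoord.contDiffOn_scalarJet (E := E3)
  have hj₀Ω : j₀ ∈ {q : (E3 →L[ℝ] E3 →L[ℝ] ℝ) × (E3 →L[ℝ] E3 →L[ℝ] E3 →L[ℝ] ℝ) ×
      (E3 →L[ℝ] E3 →L[ℝ] E3 →L[ℝ] E3 →L[ℝ] ℝ) | q.1.IsInvertible} := hA₀
  have h1 : ContDiffAt ℝ 1 𝓢 j₀ :=
    (h𝓢s.contDiffAt (hΩo.mem_nhds hj₀Ω)).of_le (by exact_mod_cast le_top)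
  obtain ⟨K, t, ht, hK⟩ := h1.exists_lipschitzOnWith
  obtain ⟨ε, hε, hεt⟩ := Metric.mem_nhds_iff.1 ht
  refine ⟨ε, K, hε, K.coe_nonneg, fun A A' B B' T T' hA hB hT hA' hB' hT' ↦ ?_⟩
  have hmem : ∀ (A₁ : E3 →L[ℝ] E3 →L[ℝ] ℝ) (B₁ : E3 →L[ℝ] E3 →L[ℝ] E3 →L[ℝ] ℝ)
      (T₁ : E3 →L[ℝ] E3 →L[ℝ] E3 →L[ℝ] E3 →L[ℝ] ℝ),
      ‖A₁ - A₀‖ < ε → ‖B₁ - B₀‖ < ε → ‖T₁ - T₀‖ < ε →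
      ((A₁, B₁, T₁) : (E3 →L[ℝ] E3 →L[ℝ] ℝ) × (E3 →L[ℝ] E3 →L[ℝ] E3 →L[ℝ] ℝ) ×
        (E3 →L[ℝ] E3 →L[ℝ] E3 →L[ℝ] E3 →L[ℝ] ℝ)) ∈ t := by
    intro A₁ B₁ T₁ h₁ h₂ h₃
    refine hεt ?_
    rw [mem_ball_iff_norm]
    have hsub : ((A₁, B₁, T₁) : (E3 →L[ℝ] E3 →L[ℝ] ℝ) × (E3 →L[ℝ] E3 →L[ℝ] E3 →L[ℝ] ℝ) ×
        (E3 →L[ℝ] E3 →L[ℝ] E3 →L[ℝ] E3 →L[ℝ] ℝ)) - j₀ = (A₁ - A₀, B₁ - B₀, T₁ - T₀) := by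
      simp only [hj₀, Prod.mk_sub_mk]
    rw [hsub, Prod.norm_mk, Prod.norm_mk]
    exact max_lt h₁ (max_lt h₂ h₃)
  have hd := (lipschitzOnWith_iff_norm_sub_le.1 hK) (hmem A' B' T' hA' hB' hT') (hmem A B T hA hB hT)
  rw [Real.norm_eq_abs] at hd
  have hsub : ((A', B', T') : (E3 →L[ℝ] E3 →L[ℝ] ℝ) × (E3 →L[ℝ] E3 →L[ℝ] E3 →L[ℝ] ℝ) ×
        (E3 →L[ℝ] E3 →L[ℝ] E3 →L[ℝ] E3 →L[ℝ] ℝ)) - (A, B, T) = (A' - A, B' - B, T' - T) := by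
    simp only [Prod.mk_sub_mk]
  rw [hsub, Prod.norm_mk, Prod.norm_mk] at hd
  exact hd

/-! ### The local bound on the core, in the atlas chart -/

variable {X : Type} [TopologicalSpace X] [ChartedSpace E3 X] [IsManifold (𝓡 3) ∞ X]

/-- Near a point of an open set, a continuous map stays `η`-close to its value and bounded. Used
for the jets of the chart components. [folklore] -/
private theorem eventually_norm_sub_lt_of_continuousOn {W : Type*} [SeminormedAddCommGroup W]
    {f : E3 → W} {V : Set E3} (hV : IsOpen V) (hf : ContinuousOn f V) {u₀ : E3} (hu₀ : u₀ ∈ V)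
    {η : ℝ} (hη : 0 < η) : ∀ᶠ u in 𝓝 u₀, ‖f u - f u₀‖ < η := by
  have hc : ContinuousAt f u₀ := (hf u₀ hu₀).continuousAt (hV.mem_nhds hu₀)
  have ht : Tendsto (fun u ↦ f u - f u₀) (𝓝 u₀) (𝓝 0) := by
    have := hc.tendsto.sub (tendsto_const_nhds (x := f u₀))
    rw [sub_self] at this
    exact this
  have ht' := tendsto_zero_iff_norm_tendsto_zero.1 ht
  exact ht'.eventually (gt_mem_nhds hη)

set_option maxHeartbeats 3200000 in
-- the chart components `chartRep` unfold to nested `gramOpFamily`/`bilinearComp` terms whose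
-- definitional unfolding is expensive (cf. `hasDerivAt_scalarCurvatureFn_ricciVariation`)
/-- **Local bound on the core** (Schoen–Yau 1979, (3.28)–(3.29) read near a point): for data `D`
and a family `D_t`, `|t| < τ`, with metric `h + t Ric(h)` pointwise, every point `x₀` has an open
neighbourhood `U` and constants `s₀ > 0`, `M ≥ 0` with `|R(D_t)(x) − R(h)(x)| ≤ |t| M` for all
`x ∈ U` and `|t| < s₀`. In the atlas chart at `x₀` the components of `h_t` are `G₀ + t T` with
`T` the (smooth) components of `Ric(h)`, so the 2-jet moves along the segment
`J_{G₀}(u) + t J_T(u)`; the jets are continuous in `u`, hence stay in a neighbourhood of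
`J_{G₀}(u₀)` on which the scalar jet function is Lipschitz (`exists_lipschitz_scalarJet_near`).
[cite: SchoenYauPMT1979, (3.28)–(3.29) (p. 73)] -/
theorem exists_nhds_abs_scalarCurvature_ricciFamily_sub_le
    (D : InitialDataSet (𝓡 3) X) [D.metric.HasLeviCivita] {τ : ℝ} (hτ : 0 < τ)
    (Dt : ℝ → InitialDataSet (𝓡 3) X)
    (hDt : ∀ t : ℝ, |t| < τ → ∀ (x : X) (v w : TangentSpace (𝓡 3) x),
      (Dt t).metric.val x v w = D.metric.val x v w + t * D.metric.ricci x v w)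
    (x₀ : X) :
    ∃ (U : Set X) (s₀ M : ℝ), IsOpen U ∧ x₀ ∈ U ∧ 0 < s₀ ∧ s₀ ≤ τ ∧ 0 ≤ M ∧
      ∀ t : ℝ, |t| < s₀ → ∀ x ∈ U,
        |(Dt t).scalarCurvatureFn x - D.scalarCurvatureFn x| ≤ |t| * M := by
  -- the chart at `x₀`, the components `G₀` of `h` and `T` of `Ric(h)`
  set g : ℝ → PseudoRiemannianMetric (𝓡 3) ∞ E3 (TangentSpace (𝓡 3) : X → Type _) :=
    fun s ↦ (Dt s).metric with hg
  set V : Set E3 := (extChartAt (𝓡 3) x₀).target with hV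
  set G : ℝ → E3 → E3 →L[ℝ] E3 →L[ℝ] ℝ := chartRep (𝓡 3) g x₀ with hGdef
  set G₀ : E3 → E3 →L[ℝ] E3 →L[ℝ] ℝ := chartRep (𝓡 3) (fun _ ↦ D.metric) x₀ 0 with hG₀
  set e := trivializationAt E3 (TangentSpace (𝓡 3) : X → Type _) x₀ with he
  set T : E3 → E3 →L[ℝ] E3 →L[ℝ] ℝ := fun y ↦
    ContinuousLinearMap.bilinearComp
      (show E3 →L[ℝ] E3 →L[ℝ] ℝ from D.metric.ricciCLM ((extChartAt (𝓡 3) x₀).symm y))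
      (show E3 →L[ℝ] E3 from e.symmL ℝ ((extChartAt (𝓡 3) x₀).symm y))
      (show E3 →L[ℝ] E3 from e.symmL ℝ ((extChartAt (𝓡 3) x₀).symm y)) with hT
  have hVopen : IsOpen V := isOpen_extChartAt_target x₀
  set u₀ : E3 := extChartAt (𝓡 3) x₀ x₀ with hu₀
  have hu₀V : u₀ ∈ V := (extChartAt (𝓡 3) x₀).map_source (mem_extChartAt_source x₀)
  -- (1) the components are affine in `t`: `G s = G₀ + s T` for `|s| < τ`
  have hGform : ∀ s : ℝ, |s| < τ → G s = fun y ↦ G₀ y + s • T y := by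
    intro s hs
    funext y
    ext v w
    exact hDt s hs _ _ _
  have hG00 : G 0 = G₀ := by
    rw [hGform 0 (by simpa using hτ)]
    funext y
    rw [zero_smul ℝ (T y), add_zero]
  -- (2) smoothness of `G₀` and `T` on `V`; `T = Ric(G₀)` there
  have hrepr₀ : ∀ u : chartTarget (𝓡 3) x₀, (chartPullback (𝓡 3) D.metric x₀).val u = G₀ u :=
    val_chartPullback_eq_chartRep (fun _ ↦ D.metric) x₀ 0
  have hmet₀ : MetricCoord.IsMetricOn G₀ V := OpensChart.isMetricOn_repr hrepr₀
  have hTeq : ∀ y ∈ V, T y = MetricCoord.ricAt G₀ y := by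
    intro y hy
    ext v w
    exact (ricAt_chartRep_apply D x₀ ⟨y, hy⟩ v w).symm
  have hG₀s : ContDiffOn ℝ ∞ G₀ V := contDiffOn_chartRep_const D.metric x₀
  have hTs : ContDiffOn ℝ ∞ T V := hmet₀.contDiffOn_ricAt.congr fun y hy ↦ hTeq y hy
  have hG₀1 : ContDiffOn ℝ ∞ (fderiv ℝ G₀) V := hG₀s.fderiv_of_isOpen (m := ∞) hVopen le_rfl
  have hT1 : ContDiffOn ℝ ∞ (fderiv ℝ T) V := hTs.fderiv_of_isOpen (m := ∞) hVopen le_rfl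
  have hG₀2 : ContDiffOn ℝ ∞ (fderiv ℝ (fderiv ℝ G₀)) V := hG₀1.fderiv_of_isOpen (m := ∞) hVopen le_rfl
  have hT2 : ContDiffOn ℝ ∞ (fderiv ℝ (fderiv ℝ T)) V := hT1.fderiv_of_isOpen (m := ∞) hVopen le_rfl
  -- (3) the jets of `G s` at points of `V`
  have hjet1 : ∀ s : ℝ, |s| < τ → ∀ y ∈ V, fderiv ℝ (G s) y = fderiv ℝ G₀ y + s • fderiv ℝ T y := by
    intro s hs y hy
    have hGd : DifferentiableAt ℝ G₀ y := ((hG₀s y hy).contDiffAt (hVopen.mem_nhds hy)).differentiableAt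
      (by simp)
    have hTd : DifferentiableAt ℝ T y := ((hTs y hy).contDiffAt (hVopen.mem_nhds hy)).differentiableAt
      (by simp)
    rw [hGform s hs, fderiv_fun_add (g := fun y ↦ s • T y) hGd (hTd.const_smul s),
      fderiv_fun_const_smul hTd]
  have hjet2 : ∀ s : ℝ, |s| < τ → ∀ y ∈ V,
      fderiv ℝ (fderiv ℝ (G s)) y = fderiv ℝ (fderiv ℝ G₀) y + s • fderiv ℝ (fderiv ℝ T) y := by
    intro s hs y hy
    have hGd : DifferentiableAt ℝ (fderiv ℝ G₀) y :=
      ((hG₀1 y hy).contDiffAt (hVopen.mem_nhds hy)).differentiableAt (by simp)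
    have hTd : DifferentiableAt ℝ (fderiv ℝ T) y :=
      ((hT1 y hy).contDiffAt (hVopen.mem_nhds hy)).differentiableAt (by simp)
    have hev : fderiv ℝ (G s) =ᶠ[𝓝 y] fun z ↦ fderiv ℝ G₀ z + s • fderiv ℝ T z := by
      filter_upwards [hVopen.mem_nhds hy] with z hz
      exact hjet1 s hs z hz
    rw [hev.fderiv_eq, fderiv_fun_add (g := fun z ↦ s • fderiv ℝ T z) hGd (hTd.const_smul s),
      fderiv_fun_const_smul hTd]
  -- (4) the Lipschitz constant of the scalar jet function near the jet of `G₀` at `u₀`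
  obtain ⟨ρ, M, hρ, hM0, hM⟩ := exists_lipschitz_scalarJet_near (G₀ u₀) (fderiv ℝ G₀ u₀)
    (fderiv ℝ (fderiv ℝ G₀) u₀) (hmet₀.isInvertible u₀ hu₀V)
  -- (5) a neighbourhood of `u₀` where the jets of `G₀` are `ρ/2`-close to their values at `u₀`
  --     and the jets of `T` are bounded by `L`
  set L : ℝ := max ‖T u₀‖ (max ‖fderiv ℝ T u₀‖ ‖fderiv ℝ (fderiv ℝ T) u₀‖) + 1 with hL
  have hL0 : 0 < L := by
    have : 0 ≤ max ‖T u₀‖ (max ‖fderiv ℝ T u₀‖ ‖fderiv ℝ (fderiv ℝ T) u₀‖) :=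
      (norm_nonneg _).trans (le_max_left _ _)
    linarith
  have hev : ∀ᶠ u in 𝓝 u₀, u ∈ V ∧ ‖G₀ u - G₀ u₀‖ < ρ / 2 ∧ ‖fderiv ℝ G₀ u - fderiv ℝ G₀ u₀‖ < ρ / 2 ∧
      ‖fderiv ℝ (fderiv ℝ G₀) u - fderiv ℝ (fderiv ℝ G₀) u₀‖ < ρ / 2 ∧
      ‖T u - T u₀‖ < 1 ∧ ‖fderiv ℝ T u - fderiv ℝ T u₀‖ < 1 ∧
      ‖fderiv ℝ (fderiv ℝ T) u - fderiv ℝ (fderiv ℝ T) u₀‖ < 1 := by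
    filter_upwards [hVopen.mem_nhds hu₀V,
      eventually_norm_sub_lt_of_continuousOn hVopen hG₀s.continuousOn hu₀V (half_pos hρ),
      eventually_norm_sub_lt_of_continuousOn hVopen hG₀1.continuousOn hu₀V (half_pos hρ),
      eventually_norm_sub_lt_of_continuousOn hVopen hG₀2.continuousOn hu₀V (half_pos hρ),
      eventually_norm_sub_lt_of_continuousOn hVopen hTs.continuousOn hu₀V one_pos,
      eventually_norm_sub_lt_of_continuousOn hVopen hT1.continuousOn hu₀V one_pos,
      eventually_norm_sub_lt_of_continuousOn hVopen hT2.continuousOn hu₀V one_pos]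
      with u h1 h2 h3 h4 h5 h6 h7
    exact ⟨h1, h2, h3, h4, h5, h6, h7⟩
  obtain ⟨O, hO, hOopen, hu₀O⟩ := _root_.eventually_nhds_iff.1 hev
  -- (6) the neighbourhood of `x₀` and the constants
  set U : Set X := (extChartAt (𝓡 3) x₀).source ∩ extChartAt (𝓡 3) x₀ ⁻¹' O with hU
  have hUopen : IsOpen U :=
    (continuousOn_extChartAt x₀).isOpen_inter_preimage (isOpen_extChartAt_source x₀) hOopen
  have hx₀U : x₀ ∈ U := ⟨mem_extChartAt_source x₀, hu₀O⟩
  set s₀ : ℝ := min τ (ρ / (2 * L)) with hs₀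
  have hs₀0 : 0 < s₀ := lt_min hτ (by positivity)
  refine ⟨U, s₀, M * L, hUopen, hx₀U, hs₀0, min_le_left _ _, mul_nonneg hM0 hL0.le,
    fun t ht x hx ↦ ?_⟩
  have htτ : |t| < τ := ht.trans_le (min_le_left _ _)
  have htL : |t| * L ≤ ρ / 2 := by
    have h1 : |t| ≤ ρ / (2 * L) := ht.le.trans (min_le_right _ _)
    rw [le_div_iff₀ (by positivity)] at h1
    linarith
  -- the point in the chart
  set u : E3 := extChartAt (𝓡 3) x₀ x with hu
  obtain ⟨huV, hg0, hg1, hg2, ht0, ht1, ht2⟩ := hO u hx.2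
  have hxinv : chartInv (𝓡 3) x₀ ⟨u, huV⟩ = x := (extChartAt (𝓡 3) x₀).left_inv hx.1
  -- the scalar curvatures through the jet function
  have hmetS : MetricCoord.IsMetricOn (G t) V :=
    OpensChart.isMetricOn_repr (val_chartPullback_eq_chartRep g x₀ t)
  have hSt : (Dt t).scalarCurvatureFn x = MetricCoord.traceCLM E3 ((G t u).inverse.comp
      (MetricCoord.ricciJet ((0 : E3), G t u, fderiv ℝ (G t) u, fderiv ℝ (fderiv ℝ (G t)) u))) := by
    rw [← hxinv, ← scalAt_chartRep_eq_scalarCurvatureFn Dt x₀ t ⟨u, huV⟩,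
      MetricCoord.scalAt_eq_scalarJet hmetS huV]
  have hS0 : D.scalarCurvatureFn x = MetricCoord.traceCLM E3 ((G₀ u).inverse.comp
      (MetricCoord.ricciJet ((0 : E3), G₀ u, fderiv ℝ G₀ u, fderiv ℝ (fderiv ℝ G₀) u))) := by
    have h := scalAt_chartRep_eq_scalarCurvatureFn Dt x₀ 0 ⟨u, huV⟩
    have h0 : (Dt 0).scalarCurvatureFn = D.scalarCurvatureFn :=
      InitialDataSet.scalarCurvatureFn_congr fun x v w ↦ by rw [hDt 0 (by simpa using hτ)]; ring
    rw [h0, hxinv] at h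
    rw [← h, show chartRep (𝓡 3) (fun s ↦ (Dt s).metric) x₀ 0 = G₀ from hG00,
      MetricCoord.scalAt_eq_scalarJet hmet₀ huV]
  -- the jets of `G t` at `u`
  have hq0 : G t u = G₀ u + t • T u := by rw [hGform t htτ]
  have hq1 : fderiv ℝ (G t) u = fderiv ℝ G₀ u + t • fderiv ℝ T u := hjet1 t htτ u huV
  have hq2 : fderiv ℝ (fderiv ℝ (G t)) u = fderiv ℝ (fderiv ℝ G₀) u + t • fderiv ℝ (fderiv ℝ T) u :=
    hjet2 t htτ u huV
  -- bounds on the perturbation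
  have hpert : ∀ {W : Type} [NormedAddCommGroup W] [NormedSpace ℝ W] (w w₀ : W),
      ‖w - w₀‖ < 1 → ‖w₀‖ + 1 ≤ L → ‖t • w‖ ≤ |t| * L := by
    intro W _ _ w w₀ hw hw₀
    rw [norm_smul, Real.norm_eq_abs]
    refine mul_le_mul_of_nonneg_left ?_ (abs_nonneg t)
    have h1 : ‖w‖ ≤ ‖w₀‖ + ‖w - w₀‖ := by
      calc ‖w‖ = ‖w₀ + (w - w₀)‖ := by congr 1; abel
        _ ≤ ‖w₀‖ + ‖w - w₀‖ := norm_add_le _ _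
    linarith
  have hLT : ‖T u₀‖ + 1 ≤ L := by
    simp only [hL]
    linarith [le_max_left ‖T u₀‖ (max ‖fderiv ℝ T u₀‖ ‖fderiv ℝ (fderiv ℝ T) u₀‖)]
  have hLT1 : ‖fderiv ℝ T u₀‖ + 1 ≤ L := by
    simp only [hL]
    linarith [le_max_left ‖fderiv ℝ T u₀‖ ‖fderiv ℝ (fderiv ℝ T) u₀‖,
      le_max_right ‖T u₀‖ (max ‖fderiv ℝ T u₀‖ ‖fderiv ℝ (fderiv ℝ T) u₀‖)]
  have hLT2 : ‖fderiv ℝ (fderiv ℝ T) u₀‖ + 1 ≤ L := by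
    simp only [hL]
    linarith [le_max_right ‖fderiv ℝ T u₀‖ ‖fderiv ℝ (fderiv ℝ T) u₀‖,
      le_max_right ‖T u₀‖ (max ‖fderiv ℝ T u₀‖ ‖fderiv ℝ (fderiv ℝ T) u₀‖)]
  have hp0 : ‖t • T u‖ ≤ |t| * L := hpert (T u) (T u₀) ht0 hLT
  have hp1 : ‖t • fderiv ℝ T u‖ ≤ |t| * L := hpert _ _ ht1 hLT1
  have hp2 : ‖t • fderiv ℝ (fderiv ℝ T) u‖ ≤ |t| * L := hpert _ _ ht2 hLT2
  -- both jets are `ρ`-close to the jet of `G₀` at `u₀`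
  have hA' : ‖G t u - G₀ u₀‖ < ρ := by
    rw [hq0, show G₀ u + t • T u - G₀ u₀ = (G₀ u - G₀ u₀) + t • T u by abel]
    refine (norm_add_le _ _).trans_lt ?_
    linarith
  have hB' : ‖fderiv ℝ (G t) u - fderiv ℝ G₀ u₀‖ < ρ := by
    rw [hq1, show fderiv ℝ G₀ u + t • fderiv ℝ T u - fderiv ℝ G₀ u₀ =
      (fderiv ℝ G₀ u - fderiv ℝ G₀ u₀) + t • fderiv ℝ T u by abel]
    refine (norm_add_le _ _).trans_lt ?_
    linarith
  have hT' : ‖fderiv ℝ (fderiv ℝ (G t)) u - fderiv ℝ (fderiv ℝ G₀) u₀‖ < ρ := by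
    rw [hq2, show fderiv ℝ (fderiv ℝ G₀) u + t • fderiv ℝ (fderiv ℝ T) u - fderiv ℝ (fderiv ℝ G₀) u₀ =
      (fderiv ℝ (fderiv ℝ G₀) u - fderiv ℝ (fderiv ℝ G₀) u₀) + t • fderiv ℝ (fderiv ℝ T) u by abel]
    refine (norm_add_le _ _).trans_lt ?_
    linarith
  -- the Lipschitz bound
  have hkey := hM (G₀ u) (G t u) (fderiv ℝ G₀ u) (fderiv ℝ (G t) u) (fderiv ℝ (fderiv ℝ G₀) u)
    (fderiv ℝ (fderiv ℝ (G t)) u) (by linarith) (by linarith) (by linarith) hA' hB' hT'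
  rw [hSt, hS0]
  refine hkey.trans ?_
  have hmax : max ‖G t u - G₀ u‖ (max ‖fderiv ℝ (G t) u - fderiv ℝ G₀ u‖
      ‖fderiv ℝ (fderiv ℝ (G t)) u - fderiv ℝ (fderiv ℝ G₀) u‖) ≤ |t| * L := by
    rw [hq0, hq1, hq2, add_sub_cancel_left, add_sub_cancel_left, add_sub_cancel_left]
    exact max_le hp0 (max_le hp1 hp2)
  calc M * max ‖G t u - G₀ u‖ (max ‖fderiv ℝ (G t) u - fderiv ℝ G₀ u‖
        ‖fderiv ℝ (fderiv ℝ (G t)) u - fderiv ℝ (fderiv ℝ G₀) u‖) ≤ M * (|t| * L) :=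
        mul_le_mul_of_nonneg_left hmax hM0
    _ = |t| * (M * L) := by ring

end Literature.Geometry.Lorentzian

end
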